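import Summits.AtomisticToContinuum.Crystallization.Theorems.PhononStability.Negative.Mirror
import Summits.AtomisticToContinuum.Crystallization.Theorems.ExcessDecayLiouvilleFarField

/-!
# Route `ExcessDecayLiouville`: the Lennard-Jones force tail over separated point sets

The force exerted on a particle `p` by a Lennard-Jones particle `q` is the summand
`(V′(|p−q|)/|p−q|)·(p−q)` of the route's `Equil` predicate; its norm is `|V′(|p−q|)|`, and
`V′(d) = −d⁻¹³ + d⁻⁷` (`deriv_lennardJones`).  Combining with the far-field bound of
`ExcessDecayLiouvilleFarField.lean` we get the estimate used by `ExcessDecay` (exterior matter acts through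
a force `O(L⁻⁴)`) and by `GrainsGlue` (the far field passes to local limits):

* `norm_ljForce_eq` : `‖(V′(d)/d)·(p−q)‖ = |V′(d)|`, `d = dist p q`, `p ≠ q`;
* `abs_deriv_lennardJones_le` : `|V′(d)| ≤ d⁻¹³ + d⁻⁷ ≤ 2 d⁻⁷` for `d ≥ 1`;
* `sum_norm_ljForce_le_of_separated` : for a finite `δ`-separated `s` whose points are at distance `≥ R`
  from `p`, `0 < δ ≤ R`, `1 ≤ R`: `Σ_{q ∈ s} ‖(V′/d)·(p−q)‖ ≤ 2048 / (δ³ R⁴)`;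
* `summable_norm_ljForce_of_separated`, `tsum_norm_ljForce_le_of_separated` : the same over an arbitrary
  `δ`-separated `X` (the subfamily at distance `≥ R`).

All `[folklore]`; helper lemmas for item stmt-AtomisticToContinuum-9334, nothing here closes an item.
-/

noncomputable section

namespace Summit.AtomisticToContinuum.Crystallization.Theorems.ExcessDecayLiouville

open scoped BigOperators Topology
open Literature.MathematicalPhysics.StatisticalMechanics
open Summit.AtomisticToContinuum.Crystallization.Theorems.PhononStabilityNegative

/-- The norm of the pair force `(V′(d)/d)·(p−q)`, `d = dist p q > 0`, is `|V′(d)|`. [folklore] -/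
theorem norm_ljForce_eq {p q : (EuclideanSpace ℝ (Fin 3))} (hpq : p ≠ q) :
    ‖(deriv lennardJones (dist p q) / dist p q) • (p - q)‖ = |deriv lennardJones (dist p q)| := by
  have hd : 0 < dist p q := dist_pos.2 hpq
  rw [norm_smul, Real.norm_eq_abs, abs_div, abs_of_pos hd, ← dist_eq_norm, div_mul_cancel₀ _ hd.ne']

/-- `|V′(d)| ≤ d⁻¹³ + d⁻⁷` for `d > 0`. [folklore] -/
theorem abs_deriv_lennardJones_le {d : ℝ} (hd : 0 < d) :
    |deriv lennardJones d| ≤ (d⁻¹) ^ 13 + (d⁻¹) ^ 7 := by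
  rw [deriv_lennardJones hd.ne']
  have h13 : 0 ≤ (d⁻¹) ^ 13 := by positivity
  have h7 : 0 ≤ (d⁻¹) ^ 7 := by positivity
  exact abs_le.2 ⟨by linarith, by linarith⟩

/-- `|V′(d)| ≤ 2 d⁻⁷` for `d ≥ 1`. [folklore] -/
theorem abs_deriv_lennardJones_le_two_mul {d : ℝ} (hd : 1 ≤ d) :
    |deriv lennardJones d| ≤ 2 * (d⁻¹) ^ 7 := by
  have hd0 : 0 < d := one_pos.trans_le hd
  refine (abs_deriv_lennardJones_le hd0).trans ?_
  have hi1 : d⁻¹ ≤ 1 := inv_le_one_of_one_le₀ hd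
  have hi0 : 0 ≤ d⁻¹ := inv_nonneg.2 hd0.le
  have : (d⁻¹) ^ 13 ≤ (d⁻¹) ^ 7 := pow_le_pow_of_le_one hi0 hi1 (by norm_num)
  linarith

/-- **Force tail, finite form.**  For a finite `δ`-separated set `s` all of whose points are at distance
`≥ R` from `p` (`0 < δ ≤ R`, `1 ≤ R`): `Σ_{q ∈ s} ‖(V′(d)/d)·(p − q)‖ ≤ 2048/(δ³R⁴)`. [folklore] -/
theorem sum_norm_ljForce_le_of_separated (s : Finset (EuclideanSpace ℝ (Fin 3))) (p : (EuclideanSpace ℝ (Fin 3))) {δ R : ℝ} (hδ : 0 < δ) (hδR : δ ≤ R)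
    (hR : 1 ≤ R) (hsep : ∀ a ∈ s, ∀ b ∈ s, a ≠ b → δ ≤ dist a b) (hfar : ∀ a ∈ s, R ≤ dist a p) :
    ∑ q ∈ s, ‖(deriv lennardJones (dist p q) / dist p q) • (p - q)‖ ≤ 2048 / (δ ^ 3 * R ^ 4) := by
  have hRpos : 0 < R := one_pos.trans_le hR
  have hterm : ∀ q ∈ s, ‖(deriv lennardJones (dist p q) / dist p q) • (p - q)‖ ≤ 2 * (dist q p)⁻¹ ^ 7 := by
    intro q hq
    have hqp : 1 ≤ dist q p := hR.trans (hfar q hq)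
    have hne : p ≠ q := by
      intro h; rw [h, dist_self] at hqp; norm_num at hqp
    rw [norm_ljForce_eq hne, dist_comm]
    exact abs_deriv_lennardJones_le_two_mul hqp
  have hmain := sum_inv_pow_le_of_separated s p (k := 4) (by norm_num) hδ hδR hsep hfar
  calc ∑ q ∈ s, ‖(deriv lennardJones (dist p q) / dist p q) • (p - q)‖
      ≤ ∑ q ∈ s, 2 * (dist q p)⁻¹ ^ 7 := Finset.sum_le_sum hterm
    _ = 2 * ∑ q ∈ s, (dist q p)⁻¹ ^ (4 + 3) := by rw [Finset.mul_sum]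
    _ ≤ 2 * (1024 / (δ ^ 3 * R ^ 4)) := by gcongr
    _ = 2048 / (δ ^ 3 * R ^ 4) := by ring

/-- **Force tail, summable form.**  For a `δ`-separated `X`, `0 < δ ≤ R`, `1 ≤ R`, the forces on `p` from the
points of `X` at distance `≥ R` form a(n absolutely) summable family. [folklore] -/
theorem summable_norm_ljForce_of_separated {X : Set (EuclideanSpace ℝ (Fin 3))} (p : (EuclideanSpace ℝ (Fin 3))) {δ R : ℝ} (hδ : 0 < δ) (hδR : δ ≤ R)
    (hR : 1 ≤ R) (hsep : ∀ a ∈ X, ∀ b ∈ X, a ≠ b → δ ≤ dist a b) :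
    Summable (fun q : {q : (EuclideanSpace ℝ (Fin 3)) // q ∈ X ∧ R ≤ dist q p} =>
      ‖(deriv lennardJones (dist p q) / dist p q) • (p - (q : (EuclideanSpace ℝ (Fin 3))))‖) := by
  refine summable_of_sum_le (fun _ => norm_nonneg _) (c := 2048 / (δ ^ 3 * R ^ 4)) fun u => ?_
  have h := sum_norm_ljForce_le_of_separated (u.map (Function.Embedding.subtype _)) p hδ hδR hR ?_ ?_
  · rwa [Finset.sum_map] at h
  · intro a ha b hb hab
    simp only [Finset.mem_map, Function.Embedding.coe_subtype] at ha hb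
    obtain ⟨a', -, rfl⟩ := ha
    obtain ⟨b', -, rfl⟩ := hb
    exact hsep _ a'.2.1 _ b'.2.1 hab
  · intro a ha
    simp only [Finset.mem_map, Function.Embedding.coe_subtype] at ha
    obtain ⟨a', -, rfl⟩ := ha
    exact a'.2.2

/-- **Force tail, `tsum` form**: `Σ' ‖(V′(d)/d)·(p − q)‖ ≤ 2048/(δ³R⁴)` over the points of a `δ`-separated
`X` at distance `≥ R` from `p` (`0 < δ ≤ R`, `1 ≤ R`). [folklore] -/
theorem tsum_norm_ljForce_le_of_separated {X : Set (EuclideanSpace ℝ (Fin 3))} (p : (EuclideanSpace ℝ (Fin 3))) {δ R : ℝ} (hδ : 0 < δ) (hδR : δ ≤ R)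
    (hR : 1 ≤ R) (hsep : ∀ a ∈ X, ∀ b ∈ X, a ≠ b → δ ≤ dist a b) :
    ∑' q : {q : (EuclideanSpace ℝ (Fin 3)) // q ∈ X ∧ R ≤ dist q p},
      ‖(deriv lennardJones (dist p q) / dist p q) • (p - (q : (EuclideanSpace ℝ (Fin 3))))‖ ≤ 2048 / (δ ^ 3 * R ^ 4) := by
  refine (summable_norm_ljForce_of_separated p hδ hδR hR hsep).tsum_le_of_sum_le fun u => ?_
  have h := sum_norm_ljForce_le_of_separated (u.map (Function.Embedding.subtype _)) p hδ hδR hR ?_ ?_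
  · rwa [Finset.sum_map] at h
  · intro a ha b hb hab
    simp only [Finset.mem_map, Function.Embedding.coe_subtype] at ha hb
    obtain ⟨a', -, rfl⟩ := ha
    obtain ⟨b', -, rfl⟩ := hb
    exact hsep _ a'.2.1 _ b'.2.1 hab
  · intro a ha
    simp only [Finset.mem_map, Function.Embedding.coe_subtype] at ha
    obtain ⟨a', -, rfl⟩ := ha
    exact a'.2.2

/-- **The far field of the force is small**: the (vector) sum of the forces on `p` from the points of a
`δ`-separated `X` at distance `≥ R` has norm `≤ 2048/(δ³R⁴)`. [folklore] -/
theorem norm_tsum_ljForce_le_of_separated {X : Set (EuclideanSpace ℝ (Fin 3))} (p : (EuclideanSpace ℝ (Fin 3))) {δ R : ℝ} (hδ : 0 < δ) (hδR : δ ≤ R)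
    (hR : 1 ≤ R) (hsep : ∀ a ∈ X, ∀ b ∈ X, a ≠ b → δ ≤ dist a b) :
    ‖∑' q : {q : (EuclideanSpace ℝ (Fin 3)) // q ∈ X ∧ R ≤ dist q p},
      (deriv lennardJones (dist p q) / dist p q) • (p - (q : (EuclideanSpace ℝ (Fin 3))))‖ ≤ 2048 / (δ ^ 3 * R ^ 4) :=
  (norm_tsum_le_tsum_norm (summable_norm_ljForce_of_separated p hδ hδR hR hsep)).trans
    (tsum_norm_ljForce_le_of_separated p hδ hδR hR hsep)

end Summit.AtomisticToContinuum.Crystallization.Theorems.ExcessDecayLiouville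

end
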